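import Summits.SmoothPoincare4.SmoothPoincare4.Theses.SymplecticOrigami
import Summits.SmoothPoincare4.SmoothPoincare4.Theorems.SymplecticOrigamiOrigamiRungStubPinchSepFunAux
import Mathlib.Geometry.Manifold.PartitionOfUnity

/-!
# Stub `stub_pinch_sepFun` of line `pair-rigidity-endgame` (crux `SymplecticOrigami.OrigamiRung`)

On a compact boundaryless `4`-manifold `M` let `V 0`, `V 1` be disjoint open sets whose common
complement is the image of a smooth embedding `z : Z → M` of a `3`-manifold and is the frontier
of each `V i`.  Then there is a smooth `τ : M → ℝ` with `V 0 = {τ < 0}`, `V 1 = {τ > 0}` (so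
`range z = {τ = 0}`) and `dτ ≠ 0` along `{τ = 0}`: a SEPARATING REGULAR FUNCTION of the fold
(`stub_pinch_sepFun`).

The proof is the manifold-ambient version of the partition-of-unity argument of the tree's
`Literature.Topology.FourManifolds.exists_definingFunction_of_sides` (Akbulut–King, proof of
Thm. 2.8.2, Assertion 2.8.2.1), over the local and calculus lemmas of part 1
(`SymplecticOrigamiOrigamiRungStubPinchSepFunAux.lean`): glue the sign-normalised slice
coordinates `ψ_y` of `exists_local_sepFun` (`ψ_y > 0 ⇔ V 1` locally off the fold) with the
constants `-1` on `V 0` and `+1` on `V 1` by a smooth partition of unity subordinate to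
`{slice domains} ∪ {V 0, V 1}` (`SmoothPartitionOfUnity.exists_isSubordinate`); off `range z`
every summand has the sign of the side, on `range z` all summands vanish, and along the
coordinate line `γ` of one slice box every `ψ_y ∘ γ` has the sign of the parameter (slope `≥ 0`)
while `ψ_{y₁} ∘ γ = id`, whence `d(τ ∘ γ)/ds (0) > 0` (`exists_pos_hasDerivAt_sum`) and
`dτ ≠ 0` (`mfderiv_ne_zero_of_hasDerivAt_comp`).
-/

noncomputable section

-- the prescribed namespace `Summit.<P>.<Sub>.…` duplicates `SmoothPoincare4` (P = Sub)
set_option linter.dupNamespace false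

open scoped Manifold ContDiff Topology ContinuousMap
open Set TopologicalSpace Filter

namespace Summit.SmoothPoincare4.SmoothPoincare4.Theorems.OrigamiRung.PairRigidityEndgame

/-- Model space `ℝⁿ`. -/
local notation "𝔼" n:arg => EuclideanSpace ℝ (Fin n)

/-! ### The stub -/

/-- **Stub P0 — separating function of the fold.**  On a compact boundaryless 4-manifold `M`
let `V 0`, `V 1` be disjoint open sets whose common complement is the image of a smooth
embedding `z` of a 3-manifold and is the frontier of each `V i`.  Then there is a smooth
`τ : M → ℝ` with `V 0 = {τ < 0}`, `V 1 = {τ > 0}` (so `range z = {τ = 0}`) and `dτ ≠ 0` along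
`{τ = 0}`.  Proof: glue the sign-normalised slice coordinates `ψ_y` of `exists_local_sepFun`
(`ψ_y > 0 ⇔ V 1` locally off the fold) with the constants `-1` on `V 0` and `+1` on `V 1` by a
smooth partition of unity subordinate to `{O_y} ∪ {V 0, V 1}`; off the fold every summand has the
sign of the side (`finsum_smul_mem_convex`), on the fold all summands vanish, and along the
coordinate line `γ` of a slice box at `x` (on which `ψ_{y₁} ∘ γ = id` and every other
`ψ_y ∘ γ` has the sign of the parameter) the derivative of `τ ∘ γ` at `0` is positive
(`exists_pos_hasDerivAt_sum`), so `dτ_x ≠ 0` (`mfderiv_ne_zero_of_hasDerivAt_comp`).  The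
Euclidean-ambient model is `Literature.Topology.FourManifolds.exists_definingFunction_of_sides`.
[folklore] -/
theorem stub_pinch_sepFun :
    ∀ (M : Type) [TopologicalSpace M] [T2Space M] [SecondCountableTopology M] [CompactSpace M]
      [ChartedSpace (𝔼 4) M] [IsManifold (𝓡 4) ∞ M]
      (V : Fin 2 → Opens M) (Z : Type) [TopologicalSpace Z] [ChartedSpace (𝔼 3) Z]
      [IsManifold (𝓡 3) ∞ Z] (z : Z → M),
      Disjoint (V 0) (V 1) →
      Manifold.IsSmoothEmbedding (𝓡 3) (𝓡 4) ∞ z →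
      Set.range z = ((V 0 : Set M) ∪ (V 1 : Set M))ᶜ →
      (∀ i, frontier (V i : Set M) = Set.range z) →
      ∃ τ : M → ℝ, ContMDiff (𝓡 4) 𝓘(ℝ, ℝ) ∞ τ ∧
        (∀ x, τ x = 0 → mfderiv (𝓡 4) 𝓘(ℝ, ℝ) τ x ≠ 0) ∧
        {x | τ x < 0} = (V 0 : Set M) ∧ {x | 0 < τ x} = (V 1 : Set M) := by
  intro M _ _ _ _ _ _ V Z _ _ _ z hdisj hz hrange hfront
  classical
  have hd : Disjoint (V 0 : Set M) (V 1) := Opens.coe_disjoint.2 hdisj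
  have hcl : ∀ i, range z ⊆ closure (V i : Set M) := fun i x hx =>
    frontier_subset_closure (by rw [hfront i]; exact hx)
  -- elementary bookkeeping of the splitting `M = V 0 ⊔ range z ⊔ V 1`
  have h01 : ∀ {x}, x ∈ (V 0 : Set M) → x ∉ (V 1 : Set M) := fun hx hx' =>
    disjoint_left.1 hd hx hx'
  have hK0 : ∀ {x}, x ∈ (V 0 : Set M) → x ∉ range z := fun {x} hx hxK => by
    rw [hrange] at hxK; exact hxK (Or.inl hx)
  have hK1 : ∀ {x}, x ∈ (V 1 : Set M) → x ∉ range z := fun {x} hx hxK => by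
    rw [hrange] at hxK; exact hxK (Or.inr hx)
  have hKV : ∀ {x}, x ∉ range z → x ∈ (V 0 : Set M) ∨ x ∈ (V 1 : Set M) := fun {x} hx => by
    rw [hrange, mem_compl_iff, not_not] at hx; exact hx
  -- local data at every point of the fold
  choose O ψ hOo hyO hψs hzero hsign hcurve using fun y =>
    exists_local_sepFun hz (V 0).isOpen (V 1).isOpen hd hrange (hcl 0) (hcl 1) y
  -- the open cover and a subordinate smooth partition of unity
  let U : Z ⊕ Bool → Set M := fun i =>
    match i with
    | Sum.inl y => O y
    | Sum.inr false => (V 0 : Set M)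
    | Sum.inr true => (V 1 : Set M)
  have hUo : ∀ i, IsOpen (U i) := by
    rintro (y | (_ | _))
    · exact hOo y
    · exact (V 0).isOpen
    · exact (V 1).isOpen
  have hUcov : (univ : Set M) ⊆ ⋃ i, U i := by
    intro x _
    rw [mem_iUnion]
    by_cases hxK : x ∈ range z
    · obtain ⟨y, rfl⟩ := hxK
      exact ⟨Sum.inl y, hyO y⟩
    · rcases hKV hxK with hx | hx
      · exact ⟨Sum.inr false, hx⟩
      · exact ⟨Sum.inr true, hx⟩
  obtain ⟨ρ, hρ⟩ :=
    SmoothPartitionOfUnity.exists_isSubordinate (𝓡 4) isClosed_univ U hUo hUcov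
  -- the local functions attached to the indices, and the glued function
  let F : Z ⊕ Bool → M → ℝ := fun i =>
    match i with
    | Sum.inl y => ψ y
    | Sum.inr false => fun _ => -1
    | Sum.inr true => fun _ => 1
  have hUinl : ∀ {y x}, x ∈ tsupport (ρ (Sum.inl y)) → x ∈ O y := fun {y x} hx =>
    hρ (Sum.inl y) hx
  have hUinr0 : ∀ {x}, x ∈ tsupport (ρ (Sum.inr false)) → x ∈ (V 0 : Set M) := fun {x} hx =>
    hρ (Sum.inr false) hx
  have hUinr1 : ∀ {x}, x ∈ tsupport (ρ (Sum.inr true)) → x ∈ (V 1 : Set M) := fun {x} hx =>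
    hρ (Sum.inr true) hx
  have hρ0 : ∀ {i x}, x ∉ tsupport (ρ i) → ρ i x = 0 := fun {i x} hx =>
    image_eq_zero_of_notMem_tsupport hx
  set τ : M → ℝ := fun x => ∑ᶠ i, ρ i x • F i x
  have hFs : ∀ i, ∀ x ∈ tsupport (ρ i), ContMDiffAt (𝓡 4) 𝓘(ℝ, ℝ) ∞ (F i) x := by
    rintro (y | (_ | _)) x hx
    · exact (hψs y).contMDiffAt ((hOo y).mem_nhds (hUinl hx))
    · exact contMDiffAt_const
    · exact contMDiffAt_const
  have hτs : ContMDiff (𝓡 4) 𝓘(ℝ, ℝ) ∞ τ := ρ.contMDiff_finsum_smul hFs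
  -- values on the fold and on the two sides
  have hτK : ∀ x ∈ range z, τ x = 0 := by
    intro x hxK
    refine finsum_eq_zero_of_forall_eq_zero fun i => ?_
    by_cases hx : x ∈ tsupport (ρ i)
    · rcases i with y | (_ | _)
      · have : ψ y x = 0 := (hzero y x (hUinl hx)).1 hxK
        simp [F, this]
      · exact absurd hxK (hK0 (hUinr0 hx))
      · exact absurd hxK (hK1 (hUinr1 hx))
    · simp [hρ0 hx]
  have hτ1 : ∀ x ∈ (V 1 : Set M), 0 < τ x := by
    intro x hx1
    suffices h : ∀ i, ρ i x ≠ 0 → F i x ∈ Ioi (0 : ℝ) from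
      ρ.finsum_smul_mem_convex (mem_univ x) h (convex_Ioi _)
    intro i hi
    have hx : x ∈ tsupport (ρ i) := subset_closure hi
    rcases i with y | (_ | _)
    · exact ((hsign y x (hUinl hx) (hK1 hx1)).1).2 hx1
    · exact absurd hx1 (h01 (hUinr0 hx))
    · show (0 : ℝ) < 1
      norm_num
  have hτ0 : ∀ x ∈ (V 0 : Set M), τ x < 0 := by
    intro x hx0
    suffices h : ∀ i, ρ i x ≠ 0 → F i x ∈ Iio (0 : ℝ) from
      ρ.finsum_smul_mem_convex (mem_univ x) h (convex_Iio _)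
    intro i hi
    have hx : x ∈ tsupport (ρ i) := subset_closure hi
    rcases i with y | (_ | _)
    · exact ((hsign y x (hUinl hx) (hK0 hx0)).2).2 hx0
    · show (-1 : ℝ) < 0
      norm_num
    · exact absurd (hUinr1 hx) (h01 hx0)
  have hτzero : ∀ x, τ x = 0 → x ∈ range z := by
    intro x h
    by_contra hxK
    rcases hKV hxK with hx | hx
    · exact (hτ0 x hx).ne h
    · exact (hτ1 x hx).ne' h
  refine ⟨τ, hτs, fun x hx => ?_, ?_, ?_⟩
  rotate_left
  · ext x
    refine ⟨fun (hx : τ x < 0) => ?_, hτ0 x⟩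
    by_contra hx0
    have hxK : x ∉ range z := fun hxK => hx.ne (hτK x hxK)
    exact lt_asymm hx (hτ1 x ((hKV hxK).resolve_left hx0))
  · ext x
    refine ⟨fun (hx : 0 < τ x) => ?_, hτ1 x⟩
    by_contra hx1
    have hxK : x ∉ range z := fun hxK => hx.ne' (hτK x hxK)
    exact lt_asymm hx (hτ0 x ((hKV hxK).resolve_right hx1))
  -- regularity on the fold
  have hxK : x ∈ range z := hτzero x hx
  obtain ⟨i₁, hi₁⟩ := ρ.exists_pos_of_mem (mem_univ x)
  set I : Finset (Z ⊕ Bool) := ρ.fintsupport x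
  have hmemI : ∀ {i}, i ∈ I → x ∈ tsupport (ρ i) := fun {i} hi =>
    (ρ.mem_fintsupport_iff x i).1 hi
  have hIinl : ∀ {i}, i ∈ I → ∃ y, i = Sum.inl y := by
    rintro (y | (_ | _)) hi
    · exact ⟨y, rfl⟩
    · exact absurd hxK (hK0 (hUinr0 (hmemI hi)))
    · exact absurd hxK (hK1 (hUinr1 (hmemI hi)))
  have hi₁I : i₁ ∈ I := (ρ.mem_fintsupport_iff x i₁).2 (subset_closure hi₁.ne')
  obtain ⟨y₁, rfl⟩ := hIinl hi₁I
  have hx₁ : x ∈ O y₁ := hUinl (hmemI hi₁I)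
  obtain ⟨γ, hγ0, hγs, hγev⟩ := hcurve y₁ x hx₁ hxK
  have hγc : ContinuousAt γ 0 := hγs.continuousAt
  have hγt : Tendsto γ (𝓝 0) (𝓝 x) := hγ0 ▸ hγc.tendsto
  -- `τ ∘ γ` is a finite sum near `0`
  have hevM : ∀ᶠ x' in 𝓝 x, τ x' = ∑ i ∈ I, ρ i x' * F i x' := by
    filter_upwards [ρ.eventually_finsupport_subset x] with x' hx'
    show ∑ᶠ i, ρ i x' • F i x' = _
    simp only [smul_eq_mul]
    refine finsum_eq_sum_of_support_subset _ fun i hi => hx' ?_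
    rw [ρ.mem_finsupport]
    exact fun h => hi (by simp [h])
  have hev : (τ ∘ γ) =ᶠ[𝓝 0] fun s => ∑ i ∈ I, ρ i (γ s) * F i (γ s) :=
    hγt.eventually hevM
  -- the calculus lemma applies
  have hρd : ∀ i ∈ I, DifferentiableAt ℝ (fun s => ρ i (γ s)) 0 := fun i _ =>
    (((ρ i).contMDiff.contMDiffAt.comp_of_eq hγs hγ0).contDiffAt).differentiableAt (by simp)
  have hFd : ∀ i ∈ I, DifferentiableAt ℝ (fun s => F i (γ s)) 0 := by
    intro i hi
    obtain ⟨y, rfl⟩ := hIinl hi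
    have hy : x ∈ O y := hUinl (hmemI hi)
    exact ((((hψs y).contMDiffAt ((hOo y).mem_nhds hy)).comp_of_eq hγs hγ0).contDiffAt
      ).differentiableAt (by simp)
  have hF0 : ∀ i ∈ I, F i (γ 0) = 0 := by
    intro i hi
    obtain ⟨y, rfl⟩ := hIinl hi
    rw [hγ0]
    exact (hzero y x (hUinl (hmemI hi))).1 hxK
  have hslope : ∀ i ∈ I, ∀ᶠ s in 𝓝[≠] (0 : ℝ), 0 ≤ s⁻¹ * F i (γ s) := by
    intro i hi
    obtain ⟨y, rfl⟩ := hIinl hi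
    have hy : x ∈ O y := hUinl (hmemI hi)
    have hOy : ∀ᶠ s in 𝓝 (0 : ℝ), γ s ∈ O y :=
      hγt.eventually ((hOo y).mem_nhds hy)
    have h' : ∀ᶠ s in 𝓝[≠] (0 : ℝ), s ≠ 0 := eventually_mem_nhdsWithin
    filter_upwards [h', mem_nhdsWithin_of_mem_nhds hOy, mem_nhdsWithin_of_mem_nhds hγev]
      with s hs hsO ⟨hs₁, hψ₁⟩
    have hsK : γ s ∉ range z := fun h => hs (hψ₁ ▸ ((hzero y₁ _ hs₁).1 h))
    obtain ⟨hposy, hnegy⟩ := hsign y _ hsO hsK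
    obtain ⟨hpos₁, hneg₁⟩ := hsign y₁ _ hs₁ hsK
    rw [hψ₁] at hpos₁ hneg₁
    show 0 ≤ s⁻¹ * ψ y (γ s)
    rcases hs.lt_or_gt with h | h
    · exact (mul_pos_of_neg_of_neg (inv_lt_zero.2 h) (hnegy.2 (hneg₁.1 h))).le
    · exact (mul_pos (inv_pos.2 h) (hposy.2 (hpos₁.1 h))).le
  have hG₁ : ∀ᶠ s in 𝓝 (0 : ℝ), F (Sum.inl y₁) (γ s) = s := hγev.mono fun s hs => hs.2
  obtain ⟨D, hD, hsum⟩ := exists_pos_hasDerivAt_sum I (w := fun i s => ρ i (γ s))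
    (G := fun i s => F i (γ s)) hρd hFd hF0 (fun i _ => ρ.nonneg i _) hslope hi₁I
    (by rw [hγ0]; exact hi₁) hG₁
  exact mfderiv_ne_zero_of_hasDerivAt_comp hγ0 (hτs.contMDiffAt.mdifferentiableAt (by simp))
    (hγs.mdifferentiableAt (by simp)) (hsum.congr_of_eventuallyEq hev) hD.ne'

end Summit.SmoothPoincare4.SmoothPoincare4.Theorems.OrigamiRung.PairRigidityEndgame

end
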